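import Mathlib
import Summits.AtomisticToContinuum.HydrodynamicLimit.Theorems.ImplosionDichotomyDenseExcursionCavityNegExpBranch
import Summits.AtomisticToContinuum.HydrodynamicLimit.Theorems.ImplosionDichotomyDenseExcursionCavityResUnique

/-!
# Uniqueness of the smooth branch at the sonic point from `q(0)`, off the jet resonances, WITHOUT a gap (T7(i) (β′))
# (crux `DenseExcursion`, line `sonic-cavity-renewal`, brick for stub `stub_cavityResolventCk`)

Helper file (`--supports stmt-AtomisticToContinuum-12586`, line lead a2, stub-worker E2 for `stub_cavityResolventCk`).
Registered helper `sonic_branch_unique`: for a monatomic tube profile, `Λ` with `Re ν(Λ) ≤ M − 1` and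
`ν(Λ) ∉ {0, 1, …, M − 1}` (on the region `Re Λ ≥ −1/5` of the pinned window `M = 5` and the condition reads
`ν(Λ) ∉ {0, 1, 2, 3}`), two `C^∞` solutions of the resolvent equation `Λŵ − linW = f`, `Λŝ − linS = g` on `(−δ′, δ′)`,
`δ′ ≤ 1`, with the same value of the regular characteristic component `q(0) = ŵ(0) − 3ŝ(0)` COINCIDE on `(−δ′, δ′)`.
Near `0` this is `fuchs_branch_unique_offjets` (reduction by `M` differentiations to the a priori bound at exponent `≤ −1`;
no quantified gap, no comparison with `x^ν`, so the statement is UNIFORMLY MEANINGFUL as `Λ` approaches a resonance); away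
from `0` it is regular uniqueness (`eqOn_of_solutions`, the characteristic speeds do not vanish off the sonic point). This is
the resonance-proof form of brick (β′) `singular_branch_unique_gap` of the T7(i) plan; it identifies the canonical local
branches (`q(0) = 1` homogeneous, `q(0) = 0` particular) of ALL the local existence theorems (`sonic_smooth_branch_gap`,
`sonic_smooth_branch_negexp`, `sonic_hom_branch_Ck`, and the future uniform branch) with each other.
Sources: folklore (Coddington–Levinson 1955 Ch. 4).
-/

noncomputable section

open Set Filter
open scoped Topology ContDiff

namespace Summit.AtomisticToContinuum.HydrodynamicLimit.Theorems.SonicCavityRenewal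

open Summit.AtomisticToContinuum.HydrodynamicLimit.Theorems.R2OneModeTwoConditions

/-- **Registered helper `sonic_branch_unique` (T7(i) (β′), gap-free): UNIQUENESS OF THE SMOOTH LOCAL SOLUTION OF THE
RESOLVENT EQUATION AT THE SONIC POINT FROM `q(0)`, OFF THE JET RESONANCES.** See the module docstring. [folklore] -/
theorem sonic_branch_unique : ∀ (r : ℝ) (W S : ℝ → ℝ), IsMonatomicProfile r W S → CavityTube r W S → ∀ (Λ : ℂ) (M : ℕ), ((((2 / 3 * deriv W 0 + 2 * deriv S 0 + 2 * W 0 + 4 * S 0 - r : ℝ) : ℂ) - Λ) / ((-(deriv W 0 + deriv S 0) : ℝ) : ℂ)).re ≤ (M : ℝ) - 1 → (∀ j : ℕ, j < M → ((((2 / 3 * deriv W 0 + 2 * deriv S 0 + 2 * W 0 + 4 * S 0 - r : ℝ) : ℂ) - Λ) / ((-(deriv W 0 + deriv S 0) : ℝ) : ℂ)) ≠ (j : ℂ)) → ∀ (f g : ℝ → ℂ), ContDiff ℝ ∞ f → ContDiff ℝ ∞ g → ∀ (δ' : ℝ), 0 < δ' → δ' ≤ 1 → ∀ (ŵ ŝ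 ŵ' ŝ' : ℝ → ℂ), ContDiffOn ℝ ∞ ŵ (Set.Ioo (-δ') δ') → ContDiffOn ℝ ∞ ŝ (Set.Ioo (-δ') δ') → ContDiffOn ℝ ∞ ŵ' (Set.Ioo (-δ') δ') → ContDiffOn ℝ ∞ ŝ' (Set.Ioo (-δ') δ') → (∀ x ∈ Set.Ioo (-δ') δ', Λ * ŵ x - linW r W S ŵ ŝ x = f x ∧ Λ * ŝ x - linS r W S ŵ ŝ x = g x) → (∀ x ∈ Set.Ioo (-δ') δ', Λ * ŵ' x - linW r W S ŵ' ŝ' x = f x ∧ Λ * ŝ' x - linS r W S ŵ' ŝ' x = g x) → ŵ 0 - 3 * ŝ 0 = ŵ' 0 - 3 * ŝ' 0 → Set.EqOn ŵ ŵ' (Set.Ioo (-δ') δ') ∧ Set.EqOn ŝ ŝ' (Set.Ioo (-δ') δ') := by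
  intro r W S hP hT Λ M hνre hνnr f g hf hg δ' hδ' hδ'1 ŵ ŝ ŵ' ŝ' hŵ hŝ hŵ' hŝ' hsol hsol' hq0
  have hncL := noncharacteristic_of_neg hP hT
  have hncR := noncharacteristic_of_pos hP hT
  obtain ⟨ρ, hρ, -, hxη, hη0, hκ, -, hne, -, -, ⟨ι₁, ι₂, hι₁, hι₂, hιeq, -⟩, -⟩ := sonic_frobenius_pair r W S hP hT 0 0
  obtain ⟨-, -, hW, hS, -, -⟩ := hP
  have hW' : ContDiff ℝ ∞ (deriv W) := (contDiff_infty_iff_deriv.1 hW).2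
  have hS' : ContDiff ℝ ∞ (deriv S) := (contDiff_infty_iff_deriv.1 hS).2
  set ν : ℂ := ((((2 / 3 * deriv W 0 + 2 * deriv S 0 + 2 * W 0 + 4 * S 0 - r : ℝ) : ℂ) - Λ) /
    ((-(deriv W 0 + deriv S 0) : ℝ) : ℂ)) with hνdef
  have hU : IsOpen (Ioo (-ρ) ρ) := isOpen_Ioo
  have h0U : (0 : ℝ) ∈ Ioo (-ρ) ρ := ⟨by linarith, hρ⟩
  set Bpp : ℝ → ℂ := fun x => ((2 / 3 * deriv W x + 2 * W x - r + 2 * deriv S x + 4 * S x : ℝ) : ℂ) with hBpp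
  set Bpm : ℝ → ℂ := fun x => ((deriv W x / 3 + deriv S x + 2 * S x : ℝ) : ℂ) with hBpm
  set Bmp : ℝ → ℂ := fun x => ((deriv W x / 3 - deriv S x - 2 * S x : ℝ) : ℂ) with hBmp
  set Bmm : ℝ → ℂ := fun x => ((2 / 3 * deriv W x + 2 * W x - r - 2 * deriv S x - 4 * S x : ℝ) : ℂ) with hBmm
  have sBpp : ContDiff ℝ ∞ Bpp := Complex.ofRealCLM.contDiff.comp (((((contDiff_const.mul hW').add
    (contDiff_const.mul hW)).sub contDiff_const).add (contDiff_const.mul hS')).add (contDiff_const.mul hS))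
  have sBpm : ContDiff ℝ ∞ Bpm := Complex.ofRealCLM.contDiff.comp (((hW'.div_const 3).add hS').add (contDiff_const.mul hS))
  have sBmp : ContDiff ℝ ∞ Bmp := Complex.ofRealCLM.contDiff.comp (((hW'.div_const 3).sub hS').sub (contDiff_const.mul hS))
  have sBmm : ContDiff ℝ ∞ Bmm := Complex.ofRealCLM.contDiff.comp (((((contDiff_const.mul hW').add
    (contDiff_const.mul hW)).sub contDiff_const).sub (contDiff_const.mul hS')).sub (contDiff_const.mul hS))
  set n₁₁ : ℝ → ℂ := fun x => (Λ - Bpp x) * ι₁ x with hn₁₁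
  set n₁₂ : ℝ → ℂ := fun x => -Bpm x * ι₁ x with hn₁₂
  set m₂₁ : ℝ → ℂ := fun x => -Bmp x * ι₂ x with hm₂₁
  set m₂₂ : ℝ → ℂ := fun x => (Λ - Bmm x) * ι₂ x with hm₂₂
  have sn₁₁ : ContDiffOn ℝ ∞ n₁₁ (Ioo (-ρ) ρ) := (contDiffOn_const.sub sBpp.contDiffOn).mul hι₁
  have sn₁₂ : ContDiffOn ℝ ∞ n₁₂ (Ioo (-ρ) ρ) := sBpm.contDiffOn.neg.mul hι₁
  have sm₂₁ : ContDiffOn ℝ ∞ m₂₁ (Ioo (-ρ) ρ) := sBmp.contDiffOn.neg.mul hι₂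
  have sm₂₂ : ContDiffOn ℝ ∞ m₂₂ (Ioo (-ρ) ρ) := (contDiffOn_const.sub sBmm.contDiffOn).mul hι₂
  have hsum0 : deriv W 0 + deriv S 0 ≠ 0 := by linarith
  have hn0 : n₁₁ 0 = ν := by
    obtain ⟨i1, -⟩ := hιeq 0 h0U
    have hs' : ((deriv W 0 : ℝ) : ℂ) + ((deriv S 0 : ℝ) : ℂ) ≠ 0 := by exact_mod_cast hsum0
    simp only [hn₁₁, hνdef, hBpp, i1, hη0]
    push_cast
    field_simp
    ring
  -- globalisation on `[−ρ/2, ρ/2]`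
  have hρ2 : (0 : ℝ) < ρ / 2 := by linarith
  have hρ2' : ρ / 2 < ρ := by linarith
  obtain ⟨A₁₁, hA₁₁, eA₁₁⟩ := exists_contDiff_eq_on_Icc hρ2 hρ2' sn₁₁
  obtain ⟨A₁₂, hA₁₂, eA₁₂⟩ := exists_contDiff_eq_on_Icc hρ2 hρ2' sn₁₂
  obtain ⟨A₂₁, hA₂₁, eA₂₁⟩ := exists_contDiff_eq_on_Icc hρ2 hρ2' sm₂₁
  obtain ⟨A₂₂, hA₂₂, eA₂₂⟩ := exists_contDiff_eq_on_Icc hρ2 hρ2' sm₂₂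
  have h0I : (0 : ℝ) ∈ Icc (-(ρ / 2)) (ρ / 2) := ⟨by linarith, by linarith⟩
  have hA0 : A₁₁ 0 = ν := (eA₁₁ h0I).trans hn0
  have sτ₁ : ContDiffOn ℝ ∞ (fun x => -(f x + 3 * g x) * ι₁ x) (Ioo (-ρ) ρ) :=
    (hf.add (contDiff_const.mul hg)).contDiffOn.neg.mul hι₁
  have sτ₂ : ContDiffOn ℝ ∞ (fun x => -(f x - 3 * g x) * ι₂ x) (Ioo (-ρ) ρ) :=
    (hf.sub (contDiff_const.mul hg)).contDiffOn.neg.mul hι₂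
  obtain ⟨T₁, hT₁, eT₁⟩ := exists_contDiff_eq_on_Icc hρ2 hρ2' sτ₁
  obtain ⟨T₂, hT₂, eT₂⟩ := exists_contDiff_eq_on_Icc hρ2 hρ2' sτ₂
  -- the interval near `0` where the first-kind form is available
  set δ₁ : ℝ := min δ' (ρ / 2) with hδ₁
  have hδ₁pos : 0 < δ₁ := lt_min hδ' hρ2
  have hsub' : Ioo (-δ₁) δ₁ ⊆ Ioo (-δ') δ' := Ioo_subset_Ioo (neg_le_neg (min_le_left _ _)) (min_le_left _ _)
  have hsubI : Ioo (-δ₁) δ₁ ⊆ Icc (-(ρ / 2)) (ρ / 2) := fun x hx =>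
    ⟨by linarith [hx.1, min_le_right δ' (ρ / 2)], by linarith [hx.2, min_le_right δ' (ρ / 2)]⟩
  have hsubρ : Ioo (-δ₁) δ₁ ⊆ Ioo (-ρ) ρ := fun x hx => ⟨by linarith [(hsubI hx).1], by linarith [(hsubI hx).2]⟩
  have hO' : IsOpen (Ioo (-δ') δ') := isOpen_Ioo
  have hdf : ∀ {φ : ℝ → ℂ}, ContDiffOn ℝ ∞ φ (Ioo (-δ') δ') → ∀ y ∈ Ioo (-δ') δ', HasDerivAt φ (deriv φ y) y :=
    fun hφ y hy => ((hφ.differentiableOn (by simp)) y hy |>.differentiableAt (hO'.mem_nhds hy)).hasDerivAt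
  -- CONVERSION: a solution of the resolvent equation gives a solution of the cut-off first-kind system on `(−δ₁, δ₁)`
  have conv : ∀ (w s : ℝ → ℂ), ContDiffOn ℝ ∞ w (Ioo (-δ') δ') → ContDiffOn ℝ ∞ s (Ioo (-δ') δ') →
      (∀ x ∈ Ioo (-δ') δ', Λ * w x - linW r W S w s x = f x ∧ Λ * s x - linS r W S w s x = g x) →
      ContDiffOn ℝ ∞ (fun x => w x + 3 * s x) (Ioo (-δ₁) δ₁) ∧ ContDiffOn ℝ ∞ (fun x => w x - 3 * s x) (Ioo (-δ₁) δ₁) ∧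
      ∀ x ∈ Ioo (-δ₁) δ₁, (x : ℂ) * deriv (fun x => w x + 3 * s x) x =
          A₁₁ x * (w x + 3 * s x) + A₁₂ x * (w x - 3 * s x) + T₁ x ∧
        deriv (fun x => w x - 3 * s x) x = A₂₁ x * (w x + 3 * s x) + A₂₂ x * (w x - 3 * s x) + T₂ x := by
    intro w s hw hs hws
    refine ⟨(hw.add (contDiffOn_const.mul hs)).mono hsub', (hw.sub (contDiffOn_const.mul hs)).mono hsub', fun x hx => ?_⟩
    have hx' := hsub' hx
    have hxI := hsubI hx
    have hxρ := hsubρ hx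
    obtain ⟨c1, c2⟩ := (lin_iff_char r W S Λ w s (f x) (g x) x).1 (hws x hx')
    have dp : deriv (fun x => w x + 3 * s x) x = deriv w x + 3 * deriv s x :=
      ((hdf hw x hx').add ((hdf hs x hx').const_mul 3)).deriv
    have dq : deriv (fun x => w x - 3 * s x) x = deriv w x - 3 * deriv s x :=
      ((hdf hw x hx').sub ((hdf hs x hx').const_mul 3)).deriv
    rw [dp, dq, eA₁₁ hxI, eA₁₂ hxI, eA₂₁ hxI, eA₂₂ hxI, eT₁ hxI, eT₂ hxI]
    obtain ⟨i1, i2⟩ := hιeq x hxρ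
    obtain ⟨hηx, hcmx⟩ := hne x hxρ
    have hinv₁ : ((dslope (fun y => W y - 1 + S y) 0 x : ℝ) : ℂ) * ι₁ x = 1 := by
      have hηC : ((dslope (fun y => W y - 1 + S y) 0 x : ℝ) : ℂ) ≠ 0 := Complex.ofReal_ne_zero.2 hηx
      rw [i1]; push_cast at hηC ⊢; field_simp
    have hinv₂ : ((W x - 1 - S x : ℝ) : ℂ) * ι₂ x = 1 := by
      have hc : ((W x - 1 - S x : ℝ) : ℂ) ≠ 0 := Complex.ofReal_ne_zero.2 hcmx.ne
      rw [i2]; push_cast at hc ⊢; field_simp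
    have hcp : ((W x - 1 + S x : ℝ) : ℂ) = (x : ℂ) * ((dslope (fun y => W y - 1 + S y) 0 x : ℝ) : ℂ) := by
      rw [← hxη x]; push_cast; ring
    rw [hcp] at c1
    simp only [hn₁₁, hn₁₂, hm₂₁, hm₂₂, hBpp, hBpm, hBmp, hBmm]
    constructor
    · linear_combination ι₁ x * c1 - ((x : ℂ) * (deriv w x + 3 * deriv s x)) * hinv₁
    · linear_combination ι₂ x * c2 - (deriv w x - 3 * deriv s x) * hinv₂
  obtain ⟨hp, hq, hpq⟩ := conv ŵ ŝ hŵ hŝ hsol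
  obtain ⟨hp', hq', hpq'⟩ := conv ŵ' ŝ' hŵ' hŝ' hsol'
  -- uniqueness near `0` from `q(0)`
  have hνre' : (A₁₁ 0).re ≤ (M : ℝ) - 1 := by rw [hA0]; exact hνre
  have hνnr' : ∀ j : ℕ, j < M → A₁₁ 0 ≠ (j : ℂ) := by rw [hA0]; exact hνnr
  obtain ⟨δ₂, hδ₂, hδ₂le, heq⟩ := fuchs_branch_unique_offjets M A₁₁ A₁₂ A₂₁ A₂₂ hA₁₁ hA₁₂ hA₂₁ hA₂₂ hνre' hνnr' T₁ T₂ hT₁ hT₂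
    _ _ _ _ δ₁ hδ₁pos hp hq hp' hq' hpq hpq' (by linear_combination hq0)
  have hnear : ∀ x ∈ Ioo (-δ₂) δ₂, ŵ x = ŵ' x ∧ ŝ x = ŝ' x := by
    intro x hx
    obtain ⟨e1, e2⟩ := heq x hx
    exact ⟨by linear_combination (e1 + e2) / 2, by linear_combination (e1 - e2) / 6⟩
  -- regular uniqueness on `(−δ′, 0)` and `(0, δ′)`
  have hδ₂δ' : δ₂ ≤ δ' := hδ₂le.trans (min_le_left _ _)
  have hdiff : ∀ {w s : ℝ → ℂ}, ContDiffOn ℝ ∞ w (Ioo (-δ') δ') → ContDiffOn ℝ ∞ s (Ioo (-δ') δ') →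
      ∀ (a b : ℝ), Ioo a b ⊆ Ioo (-δ') δ' → ∀ x ∈ Ioo a b, DifferentiableAt ℝ w x ∧ DifferentiableAt ℝ s x :=
    fun hw hs a b hab x hx => ⟨(hdf hw x (hab hx)).differentiableAt, (hdf hs x (hab hx)).differentiableAt⟩
  have hL : Ioo (-δ') 0 ⊆ Ioo (-δ') δ' := fun x hx => ⟨hx.1, hx.2.trans hδ'⟩
  have hR : Ioo 0 δ' ⊆ Ioo (-δ') δ' := fun x hx => ⟨by linarith [hx.1], hx.2⟩
  obtain ⟨eqwL, eqsL⟩ := eqOn_of_solutions (r := r) hW hS (t₀ := -(δ₂ / 2)) (α := -δ') (β := 0)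
    ⟨by linarith, by linarith⟩ (fun x hx => hncL x hx.2) (Λ := Λ) (f := f) (g := g) (hdiff hŵ hŝ _ _ hL) (hdiff hŵ' hŝ' _ _ hL)
    (fun x hx => hsol x (hL hx)) (fun x hx => hsol' x (hL hx)) (hnear _ ⟨by linarith, by linarith⟩).1
    (hnear _ ⟨by linarith, by linarith⟩).2
  obtain ⟨eqwR, eqsR⟩ := eqOn_of_solutions (r := r) hW hS (t₀ := δ₂ / 2) (α := 0) (β := δ')
    ⟨by linarith, by linarith⟩ (fun x hx => hncR x hx.1) (Λ := Λ) (f := f) (g := g) (hdiff hŵ hŝ _ _ hR) (hdiff hŵ' hŝ' _ _ hR)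
    (fun x hx => hsol x (hR hx)) (fun x hx => hsol' x (hR hx)) (hnear _ ⟨by linarith, by linarith⟩).1
    (hnear _ ⟨by linarith, by linarith⟩).2
  have hall : ∀ x ∈ Ioo (-δ') δ', ŵ x = ŵ' x ∧ ŝ x = ŝ' x := by
    intro x hx
    rcases lt_trichotomy x 0 with h | rfl | h
    · exact ⟨eqwL ⟨hx.1, h⟩, eqsL ⟨hx.1, h⟩⟩
    · exact hnear 0 ⟨by linarith, hδ₂⟩
    · exact ⟨eqwR ⟨h, hx.2⟩, eqsR ⟨h, hx.2⟩⟩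
  exact ⟨fun x hx => (hall x hx).1, fun x hx => (hall x hx).2⟩

end Summit.AtomisticToContinuum.HydrodynamicLimit.Theorems.SonicCavityRenewal

end
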